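import Literature.NumberTheory.GaloisRepresentations.KummerCorestrictionNorm
import Literature.NumberTheory.EllipticCurves.KummerUnramifiedConverse
import HarnessLib

/-!
# Kummer classes with `μ_N` coefficients on a SUBGROUP `U ≤ Γ_K`:
# `κ_U(β) = [σ ↦ σβ/β] ∈ H¹(U, μ_N)` for `β ∈ K̄ˣ` with `β^N` fixed by `U`
# (the Kummer map `Lˣ/Lˣᴺ → H¹(L, μ_N)` of the layer `L = K̄^U`, read in the tree's subgroup model)

Topic `NumberTheory/GaloisRepresentations`; namespace `Literature.NumberTheory.GaloisRepresentations`.  Definitions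
with bodies and theorems only: **no named fact is introduced** (D-0026); no instance, no notation, no `sorry`.

The tree has Kummer theory with `μ_N` coefficients for the WHOLE group `Γ_K` (`kummerUnits`, `kummerOneCocycle`,
`kummerClassHom`, `kummerMap`, the Kummer isomorphism `kummerEquiv` — `GaloisCohomologyKummerProofs.lean`; Serre,
*Galois Cohomology* II §1.2), the subgroup model of the cohomology of a layer `Hⁿ(U, X) = Hⁿ(K̄^U, X)`
(`subgroupRep`, `resLe`, `conjMap`, `coresLe` — `ContinuousCorestriction.lean`), the transfer formula
`cor ∘ Kummer = Kummer ∘ (∏ over coset representatives)` for `μ_N`-valued Kummer cocycles of an open subgroup of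
`Γ_K` (`KummerCorestrictionNorm.lean`), and the subgroup Kummer classes of POINTS of an elliptic curve
(`WeierstrassCurve.subgroupKummerClass`, `EllipticCurves/SubgroupKummerClass.lean`).  This file is the missing
`μ_N`-coefficient analogue ON A SUBGROUP — the Kummer classes of the units of the LAYERS of a tower (Iwasawa
theory reads the elliptic / cyclotomic units of `K_n` in `H¹(K_n, μ_{p^k})` and pushes them around by `res`,
`cor` and the Galois action; Kato, Astérisque 295 §15.5–15.12, Rubin, *Euler Systems* III §3.3, de Shalit II §4):

* §1 `subgroupKummerUnits K N U` — the `β ∈ K̄ˣ` with `β^N` fixed by `U` (Serre II §1.2 with `Γ_K` replaced by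
  `U`); antitone in `U`; contains `kummerUnits K N`, the `U`-fixed units and `μ_N`; stable under `Γ_K` for `U`
  normal; the «norm element» `∏_{x ∈ U'/U} s(x)·β` of `β ∈ subgroupKummerUnits K N U` lies in
  `subgroupKummerUnits K N U'` (`prod_smul_mem_subgroupKummerUnits`).
* §2 `muSubgroupKummerCocycle K N U β : contOneCocycles (subgroupRep (mu K N).toTopRep U)`, `σ ↦ σβ/β` — a
  CONTINUOUS crossed homomorphism of `U` (values read in `K̄ˣ` by `muVal`, `muVal_muSubgroupKummerCocycle_apply`);
  multiplicative in `β`; vanishes iff `β` is `U`-fixed; restriction to `U' ≤ U`, restriction of the `Γ_K`-cocycle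
  `kummerOneCocycle`, conjugation by `g ∈ Γ_K` (`= cocycle of g•β`), change of level along any power map
  `π : μ_M → μ_N`, `M = N·d` (`= cocycle of β^d`) — all as EQUALITIES OF COCYCLES.
* §3 `muSubgroupKummerClass` / `muSubgroupKummerClassHom` — the class `κ_U(β) ∈ H¹(U, μ_N)`; depends on `β^N`
  only (`…_eq_of_pow_eq`: two roots differ by `ζ ∈ μ_N`, whose cocycle is the coboundary `∂ζ`); the Kummer MAP of
  the layer `muSubgroupKummerMap K N U : (K̄ˣ)^U →* H¹(U, μ_N)`, `b ↦ κ_U(b^{1/N})` (`subgroupKummerUnitsRoot`, any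
  `N ≥ 1`: `K̄` is algebraically closed), killing `N`-th powers of `U`-fixed units.
* §4 functoriality of the class: `resLe`, `resSubgroup ∘ kummerClassHom`, `conjMap` (`g·κ_U(β) = κ_U(gβ)`), and
  ★ `coresLe_muSubgroupKummerClass`: **`cor_{U'/U} κ_U(β) = κ_{U'}(∏_{x ∈ U'/U} s(x)·β)`** for `U ≤ U'`, `U` open of
  finite index in `U'` and ANY section `s` of `U' → U'/U` (the relative form of `cores_oneCocycleClass_of_kummer`;
  `(∏ s(x)·β)^N = ∏ s(x)·β^N` is the coset-product = norm of `b = β^N` from `K̄^U` to `K̄^{U'}`, `prod_smul_pow_eq`),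
  with the root-free corollary `coresLe_muSubgroupKummerClass_eq_of_pow_eq`.
* §5 ★ `muSubgroupKummerCocycle_apply_eq_zero_of_mem_inertia`: for `β` a `𝔓`-UNIT of `ℤ̄_K`
  (`𝔓 ∌ N`) the cocycle vanishes on `U ⊓ I_𝔓` — `K̄^U(β)/K̄^U` is unramified at `𝔓` (Lang, *FDG* Ch. 6 Prop. 1.3 via
  the tree's `smul_eq_self_of_mem_inertia_of_pow_eq`); hence `res_{U ⊓ I_𝔓} κ_U(β) = 0`
  (`resLe_inf_inertia_muSubgroupKummerClass`), the unramified-away-from-`N` condition in the currency of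
  `Kato2004.CM.integralH1K`.

GENERALISE-VS-DUPLICATE (director (729)): this file GENERALISES the tree's `Γ_K`-level Kummer constructions
(`kummerUnits` / `kummerOneCocycle` / `kummerClassHom` / `kummerMap` of `GaloisCohomologyKummerProofs.lean`, and
`cores_oneCocycleClass_of_kummer` of `KummerCorestrictionNorm.lean`, all imported and used BY NAME) from `Γ_K` to an
arbitrary subgroup `U ≤ Γ_K`; `U = Γ_K` recovers them (`kummerUnits_le_subgroupKummerUnits`,
`pullback_subtype_kummerOneCocycle`, `resSubgroup_kummerClassHom`); nothing is re-declared.  Prior art not importable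
into Literature: the Summits-side `KummerSubgroup.exists_cocycle` (`Summits/…/GaloisImage/KummerSubgroupCocycles.lean`,
EXISTENCE of the cocycle on `galFixing k E` only); this file gives the DEFINITION on an arbitrary subgroup with its API.
CONSUMER BY NAME: stages S1/S3/S4 of `Literature/NumberTheory/EllipticCurves/Kato2004/EllipticUnitKummerCupMap.lean`
(row K2C-8 (C5) of cell `bsd-cm`, Kato's map (15.12.1)∘15.14: the corestricted Kummer–cup classes
`cor_{K(p^s𝔣)/Kℚ_n}(κ_{U_s}(z_s^{1/p^k}) ∪ e) ∈ H¹(Kℚ_n, E[p^k])` of Kato's elliptic units `z_s`) and its S5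
`Kato2004/EllipticUnitKummerCupClass.lean`.  HONEST FRAMING: classical Galois-cohomological bookkeeping over an
arbitrary field; nothing about elliptic curves or BSD; no summit statement is proved.

## References

* [SerreGaloisCohomology1997] J.-P. Serre, *Galois Cohomology* (1997), I §2.2–§2.5 (cochains, res, cor, the action
  of `G/H` on `Hⁿ(H, A)`), II §1.2 (Kummer theory).
* [Serre1979] J.-P. Serre, *Local Fields* (1979), VII §5, X §3 b) (Kummer theory; `cor` and the norm).
* [NeukirchSchmidtWingberg2008] J. Neukirch, A. Schmidt, K. Wingberg, *Cohomology of Number Fields* (2008), I §5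
  (corestriction on inhomogeneous cochains; `cor ∘ res`, `cor` in degree `0` is the norm).
* [Lang1983] S. Lang, *Fundamentals of Diophantine Geometry* (1983), Ch. 6 Prop. 1.3 (Kummer extensions by roots
  of units are unramified).
* [Rubin2000] K. Rubin, *Euler Systems* (2000), III §3.3–§3.4 (elliptic / cyclotomic units as classes in
  `H¹(K_n, ℤ_p(1))` via Kummer theory, norm-compatibility = corestriction-compatibility).
-/

noncomputable section

open Field Topology

namespace Literature.NumberTheory.GaloisRepresentations

open DiscreteGaloisModule
open Literature.NumberTheory.EllipticCurves (schreierElt schreierElt_coe subgroupInclusion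
  subgroupInclusion_apply_coe subgroupConj subgroupConj_apply_coe smul_eq_self_of_mem_inertia_of_pow_eq)

universe u

variable (K : Type u) [Field K] (N : ℕ)

/-! ## §1 Kummer units of a subgroup -/

section Units

variable (U : Subgroup (absoluteGaloisGroup K))

/-- **Kummer units of the subgroup `U ≤ Γ_K`**: the units `β ∈ K̄ˣ` whose `N`-th power is fixed by `U`
(`β^N = b ∈ (K̄^U)ˣ`, i.e. `β` is an `N`-th root of a unit of the layer `L = K̄^U`) — the domain of the
Kummer cocycles `σ ↦ σβ/β` of `U`.  For `U = Γ_K` this is the tree's `kummerUnits K N`.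
[cite: SerreGaloisCohomology1997, II §1.2] -/
def subgroupKummerUnits : Subgroup (AlgebraicClosure K)ˣ where
  carrier := {β | ∀ σ : U, (σ : absoluteGaloisGroup K) • β ^ N = β ^ N}
  one_mem' σ := by simp
  mul_mem' {a b} ha hb σ := by
    simp only [Set.mem_setOf_eq] at ha hb ⊢
    rw [mul_pow, smul_mul', ha σ, hb σ]
  inv_mem' {a} ha σ := by
    simp only [Set.mem_setOf_eq] at ha ⊢
    rw [inv_pow, smul_inv', ha σ]

variable {K N U} in
/-- Membership in `subgroupKummerUnits`. [cite: SerreGaloisCohomology1997, II §1.2] -/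
theorem mem_subgroupKummerUnits_iff (β : (AlgebraicClosure K)ˣ) :
    β ∈ subgroupKummerUnits K N U ↔ ∀ σ : U, (σ : absoluteGaloisGroup K) • β ^ N = β ^ N :=
  Iff.rfl

variable {U} in
/-- `subgroupKummerUnits` is antitone in the subgroup: a smaller subgroup fixes more (the tower `Lˣ ⊆ L'ˣ`).
[cite: SerreGaloisCohomology1997, II §1.2] -/
theorem subgroupKummerUnits_anti {U' : Subgroup (absoluteGaloisGroup K)} (h : U' ≤ U) :
    subgroupKummerUnits K N U ≤ subgroupKummerUnits K N U' :=
  fun _ hβ σ ↦ hβ ⟨σ, h σ.2⟩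

/-- Kummer units of `Γ_K` are Kummer units of every subgroup. [cite: SerreGaloisCohomology1997, II §1.2] -/
theorem kummerUnits_le_subgroupKummerUnits : kummerUnits K N ≤ subgroupKummerUnits K N U :=
  fun _ hβ σ ↦ hβ σ

variable {K N U} in
/-- A unit fixed by `U` is a Kummer unit of `U`. [cite: SerreGaloisCohomology1997, II §1.2] -/
theorem mem_subgroupKummerUnits_of_forall_smul_eq {β : (AlgebraicClosure K)ˣ}
    (hβ : ∀ σ : U, (σ : absoluteGaloisGroup K) • β = β) : β ∈ subgroupKummerUnits K N U :=
  fun σ ↦ by rw [smul_pow', hβ σ]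

variable {K N U} in
/-- An `N`-th root of unity is a Kummer unit of every subgroup (`β^N = 1` is fixed). [cite: SerreGaloisCohomology1997, II §1.2] -/
theorem mem_subgroupKummerUnits_of_pow_eq_one {β : (AlgebraicClosure K)ˣ} (hβ : β ^ N = 1) :
    β ∈ subgroupKummerUnits K N U :=
  fun σ ↦ by rw [hβ, smul_one]

variable {K N U} in
/-- For `U` normal in `Γ_K`, the Kummer units of `U` are stable under `Γ_K`:
`σ(gβ)^N = g((g⁻¹σg)β^N) = gβ^N`. [cite: Serre1979, VII §5] -/
theorem smul_mem_subgroupKummerUnits_of_normal [U.Normal] (g : absoluteGaloisGroup K)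
    {β : (AlgebraicClosure K)ˣ} (hβ : β ∈ subgroupKummerUnits K N U) :
    g • β ∈ subgroupKummerUnits K N U := by
  intro σ
  have hmem : g⁻¹ * (σ : absoluteGaloisGroup K) * g ∈ U := by
    simpa using Subgroup.Normal.conj_mem inferInstance (σ : absoluteGaloisGroup K) σ.2 g⁻¹
  have h := hβ ⟨_, hmem⟩
  change (g⁻¹ * (σ : absoluteGaloisGroup K) * g) • β ^ N = β ^ N at h
  calc (σ : absoluteGaloisGroup K) • (g • β) ^ N
      = g • ((g⁻¹ * (σ : absoluteGaloisGroup K) * g) • β ^ N) := by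
        rw [← smul_pow', smul_smul, smul_smul, ← mul_assoc, ← mul_assoc, mul_inv_cancel, one_mul]
    _ = (g • β) ^ N := by rw [h, smul_pow']

variable {K N U} in
/-- `β ^ d` is a Kummer unit of level `N` when `β` is one of level `M = N·d`. [cite: SerreGaloisCohomology1997, II §1.2] -/
theorem pow_mem_subgroupKummerUnits_of_mul_eq {M d : ℕ} (hM : N * d = M) {β : (AlgebraicClosure K)ˣ}
    (hβ : β ∈ subgroupKummerUnits K M U) : β ^ d ∈ subgroupKummerUnits K N U := fun σ ↦ by
  rw [← pow_mul, mul_comm, hM]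
  exact hβ σ

end Units

/-! ### The norm element `∏_{x ∈ U'/U} s(x)·β` -/

section NormElt

variable {U U' : Subgroup (absoluteGaloisGroup K)} [Fintype (U' ⧸ U.subgroupOf U')]
  {s : U' ⧸ U.subgroupOf U' → U'}

variable {K N} in
/-- `(∏ₓ s(x)·β)^N = ∏ₓ s(x)·β^N`: the `N`-th power of the norm element of `β` is the coset-product («norm from
`K̄^U` to `K̄^{U'}`») of `b = β^N`. [cite: NeukirchSchmidtWingberg2008, I §5 (cor in degree 0 is the norm)]
[cite: Serre1979, X §3 b)] -/
theorem prod_smul_pow_eq (β : (AlgebraicClosure K)ˣ) :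
    (∏ x : U' ⧸ U.subgroupOf U', ((s x : U') : absoluteGaloisGroup K) • β) ^ N =
      ∏ x : U' ⧸ U.subgroupOf U', ((s x : U') : absoluteGaloisGroup K) • β ^ N := by
  rw [← Finset.prod_pow]
  exact Finset.prod_congr rfl fun x _ ↦ (smul_pow' _ β N).symm

variable {K N} in
/-- **The norm element of a Kummer unit of `U` is a Kummer unit of `U'`** (`s` a section of `U' → U'/(U ⊓ U')`;
meant for `U ≤ U'`): `τ·∏ₓ s(x)β^N = ∏ₓ s(τx)·(h_x β^N) = ∏ₓ s(x)β^N` for `τ ∈ U'`, with `τ s(x) = s(τx) h_x`, `h_x ∈ U`.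
[cite: NeukirchSchmidtWingberg2008, I §5] [cite: Serre1979, X §3 b)] -/
theorem prod_smul_mem_subgroupKummerUnits (hs : ∀ x, (s x : U' ⧸ U.subgroupOf U') = x)
    {β : (AlgebraicClosure K)ˣ} (hβ : β ∈ subgroupKummerUnits K N U) :
    (∏ x : U' ⧸ U.subgroupOf U', ((s x : U') : absoluteGaloisGroup K) • β) ∈ subgroupKummerUnits K N U' := by
  intro τ
  rw [prod_smul_pow_eq, Finset.smul_prod']
  have key : ∀ x : U' ⧸ U.subgroupOf U',
      (τ : absoluteGaloisGroup K) • (((s x : U') : absoluteGaloisGroup K) • β ^ N) =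
        ((s (τ • x) : U') : absoluteGaloisGroup K) • β ^ N := by
    intro x
    have hx : ((schreierElt (U.subgroupOf U') hs τ x : U.subgroupOf U') : U') =
        (s (τ • x))⁻¹ * τ * s x := schreierElt_coe _ hs τ x
    have hmem : (((s (τ • x))⁻¹ * τ * s x : U') : absoluteGaloisGroup K) ∈ U := by
      have := (schreierElt (U.subgroupOf U') hs τ x).2
      rw [Subgroup.mem_subgroupOf, hx] at this
      exact this
    have hfix := hβ ⟨_, hmem⟩
    change (((s (τ • x))⁻¹ * τ * s x : U') : absoluteGaloisGroup K) • β ^ N = β ^ N at hfix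
    calc (τ : absoluteGaloisGroup K) • (((s x : U') : absoluteGaloisGroup K) • β ^ N)
        = ((s (τ • x) : U') : absoluteGaloisGroup K) •
            ((((s (τ • x))⁻¹ * τ * s x : U') : absoluteGaloisGroup K) • β ^ N) := by
          rw [smul_smul, smul_smul, Subgroup.coe_mul, Subgroup.coe_mul, Subgroup.coe_inv, ← mul_assoc,
            ← mul_assoc, mul_inv_cancel, one_mul]
      _ = ((s (τ • x) : U') : absoluteGaloisGroup K) • β ^ N := by rw [hfix]
  rw [Finset.prod_congr rfl fun x _ ↦ key x]
  exact Equiv.prod_comp (MulAction.toPerm τ) (fun y ↦ ((s y : U') : absoluteGaloisGroup K) • β ^ N)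

end NormElt

/-! ## §2 The Kummer cocycle `σ ↦ σβ/β` of `U` with values in `μ_N` -/

section Cocycle

variable (U : Subgroup (absoluteGaloisGroup K))

/-- The root of unity `σβ/β ∈ μ_N(K̄)` for `β` a Kummer unit of `U` and `σ ∈ U`.
[cite: SerreGaloisCohomology1997, II §1.2] -/
def subgroupKummerRootOfUnity (β : subgroupKummerUnits K N U) (σ : U) :
    rootsOfUnity N (AlgebraicClosure K) :=
  ⟨(σ : absoluteGaloisGroup K) • (β : (AlgebraicClosure K)ˣ) / β, by
    rw [mem_rootsOfUnity, div_pow, ← smul_pow', β.2 σ, div_self']⟩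

/-- Unfolding `subgroupKummerRootOfUnity`. [cite: SerreGaloisCohomology1997, II §1.2] -/
@[simp] theorem coe_subgroupKummerRootOfUnity (β : subgroupKummerUnits K N U) (σ : U) :
    (subgroupKummerRootOfUnity K N U β σ : (AlgebraicClosure K)ˣ) =
      (σ : absoluteGaloisGroup K) • (β : (AlgebraicClosure K)ˣ) / β :=
  rfl

/-- The Kummer cocycle `σ ↦ σβ/β` of `U` as a function `U → MuCarrier K N`. [cite: SerreGaloisCohomology1997, II §1.2] -/
def muSubgroupKummerCocycleFun (β : subgroupKummerUnits K N U) : U → MuCarrier K N :=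
  fun σ ↦ MuCarrier.ofRootsOfUnity (subgroupKummerRootOfUnity K N U β σ)

/-- Values of `muSubgroupKummerCocycleFun` in `K̄ˣ`. [cite: SerreGaloisCohomology1997, II §1.2] -/
@[simp] theorem muVal_muSubgroupKummerCocycleFun (β : subgroupKummerUnits K N U) (σ : U) :
    muVal K N (muSubgroupKummerCocycleFun K N U β σ) =
      (σ : absoluteGaloisGroup K) • (β : (AlgebraicClosure K)ˣ) / β :=
  rfl

/-- The Kummer cocycle of `U` is locally constant (the stabiliser of `β` in `Γ_K` is open): continuity of
cochains for the Krull topology. [cite: SerreGaloisCohomology1997, I §2.2, II §1.2] -/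
theorem isLocallyConstant_muSubgroupKummerCocycleFun (β : subgroupKummerUnits K N U) :
    IsLocallyConstant (muSubgroupKummerCocycleFun K N U β) := by
  refine IsLocallyConstant.desc _ (muVal K N) ?_ (muVal_injective K N)
  have h1 : IsLocallyConstant fun σ : U ↦ (σ : absoluteGaloisGroup K) • (β : (AlgebraicClosure K)ˣ) :=
    (isLocallyConstant_smul_units K (β : (AlgebraicClosure K)ˣ)).comp_continuous continuous_subtype_val
  exact h1.div (IsLocallyConstant.const _)

/-- **The Kummer cocycle of `β` on the subgroup `U`**: `σ ↦ σβ/β ∈ μ_N(K̄)`, a continuous `1`-cocycle of `U`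
with values in the restriction `μ_N|_U` (`subgroupRep (mu K N).toTopRep U`) — `στβ/β = (σβ/β)·σ(τβ/β)`.  For
`U = Gal(K̄/L)` it is the Kummer cocycle of `b = β^N ∈ Lˣ` over the LAYER `L`.
[cite: SerreGaloisCohomology1997, II §1.2] [cite: Serre1979, X §3] -/
def muSubgroupKummerCocycle (β : subgroupKummerUnits K N U) :
    contOneCocycles (subgroupRep (mu K N).toTopRep U) :=
  ⟨⟨muSubgroupKummerCocycleFun K N U β, (isLocallyConstant_muSubgroupKummerCocycleFun K N U β).continuous⟩,
    fun σ τ ↦ muVal_injective K N (by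
      change muVal K N (muSubgroupKummerCocycleFun K N U β (σ * τ)) =
        muVal K N (muSubgroupKummerCocycleFun K N U β σ +
          (mu K N).toContRepresentation (σ : absoluteGaloisGroup K) (muSubgroupKummerCocycleFun K N U β τ))
      rw [muVal_add, muVal_toContRepresentation_apply, muVal_muSubgroupKummerCocycleFun,
        muVal_muSubgroupKummerCocycleFun, muVal_muSubgroupKummerCocycleFun, Subgroup.coe_mul, mul_smul,
        smul_div', mul_comm, div_mul_div_cancel])⟩

/-- Values of the Kummer cocycle of `U` read in `K̄ˣ`: `κ_U(β)(σ) = σβ/β`. [cite: SerreGaloisCohomology1997, II §1.2] -/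
@[simp] theorem muVal_muSubgroupKummerCocycle_apply (β : subgroupKummerUnits K N U) (σ : U) :
    muVal K N ((muSubgroupKummerCocycle K N U β).1 σ) =
      (σ : absoluteGaloisGroup K) • (β : (AlgebraicClosure K)ˣ) / β :=
  rfl

variable {K N U} in
/-- `μ_N|_U`-valued cocycles of `U` are determined by their values in `K̄ˣ` (`μ_N(K̄) ⊆ K̄ˣ`).
[cite: SerreGaloisCohomology1997, I §2.2, II §1.2] -/
theorem subgroup_mu_cocycle_eq_of_muVal_eq {φ ψ : contOneCocycles (subgroupRep (mu K N).toTopRep U)}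
    (h : ∀ σ, muVal K N (φ.1 σ) = muVal K N (ψ.1 σ)) : φ = ψ :=
  Subtype.ext (ContinuousMap.ext fun σ ↦ muVal_injective K N (h σ))

/-- The Kummer cocycle of `U` is multiplicative in `β`, on the nose. [cite: SerreGaloisCohomology1997, II §1.2] -/
theorem muSubgroupKummerCocycle_mul (β β' : subgroupKummerUnits K N U) :
    muSubgroupKummerCocycle K N U (β * β') =
      muSubgroupKummerCocycle K N U β + muSubgroupKummerCocycle K N U β' :=
  subgroup_mu_cocycle_eq_of_muVal_eq fun σ ↦ by
    change muVal K N ((muSubgroupKummerCocycle K N U (β * β')).1 σ) =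
      muVal K N ((muSubgroupKummerCocycle K N U β).1 σ + (muSubgroupKummerCocycle K N U β').1 σ)
    rw [muVal_add, muVal_muSubgroupKummerCocycle_apply, muVal_muSubgroupKummerCocycle_apply,
      muVal_muSubgroupKummerCocycle_apply, Subgroup.coe_mul, smul_mul', mul_div_mul_comm]

/-- The Kummer cocycle of `1` vanishes. [cite: SerreGaloisCohomology1997, II §1.2] -/
@[simp] theorem muSubgroupKummerCocycle_one : muSubgroupKummerCocycle K N U 1 = 0 := by
  have h := muSubgroupKummerCocycle_mul K N U 1 1
  rwa [mul_one, left_eq_add] at h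

variable {K N U} in
/-- The Kummer cocycle of a `U`-FIXED unit vanishes identically. [cite: SerreGaloisCohomology1997, II §1.2] -/
theorem muSubgroupKummerCocycle_eq_zero_of_forall_smul_eq (β : subgroupKummerUnits K N U)
    (hβ : ∀ σ : U, (σ : absoluteGaloisGroup K) • (β : (AlgebraicClosure K)ˣ) = β) :
    muSubgroupKummerCocycle K N U β = 0 :=
  subgroup_mu_cocycle_eq_of_muVal_eq fun σ ↦ by
    rw [muVal_muSubgroupKummerCocycle_apply, hβ σ, div_self']
    rfl

variable {K N U} in
/-- Conversely, if the Kummer cocycle vanishes identically then `β` is `U`-fixed. [cite: SerreGaloisCohomology1997, II §1.2] -/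
theorem forall_smul_eq_of_muSubgroupKummerCocycle_eq_zero (β : subgroupKummerUnits K N U)
    (h : muSubgroupKummerCocycle K N U β = 0) (σ : U) :
    (σ : absoluteGaloisGroup K) • (β : (AlgebraicClosure K)ˣ) = β := by
  have h1 : muVal K N ((muSubgroupKummerCocycle K N U β).1 σ) =
      muVal K N ((0 : contOneCocycles (subgroupRep (mu K N).toTopRep U)).1 σ) := by rw [h]
  rw [muVal_muSubgroupKummerCocycle_apply] at h1
  change _ = muVal K N 0 at h1
  rw [muVal_zero, div_eq_one] at h1
  exact h1

/-- **Restriction to a smaller subgroup**, cocycle level: the pull-back of `κ_U(β)` along `U' ↪ U` is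
`κ_{U'}(β)`. [cite: SerreGaloisCohomology1997, I §2.4] -/
theorem pullback_inclusion_muSubgroupKummerCocycle {U' : Subgroup (absoluteGaloisGroup K)} (h : U' ≤ U)
    (β : subgroupKummerUnits K N U) :
    contOneCocycles.pullback (subgroupInclusion h) (X := subgroupRep (mu K N).toTopRep U)
        (Y := subgroupRep (mu K N).toTopRep U')
        (TopRep.ofHom ⟨ContinuousLinearMap.id ℤ (mu K N).toTopRep, fun _ ↦ rfl⟩)
        (muSubgroupKummerCocycle K N U β) =
      muSubgroupKummerCocycle K N U' ⟨β, subgroupKummerUnits_anti K N h β.2⟩ :=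
  subgroup_mu_cocycle_eq_of_muVal_eq fun _ ↦ rfl

/-- **Restriction of the `Γ_K`-Kummer cocycle**, cocycle level: the pull-back of the tree's `kummerOneCocycle K N α`
along `U ↪ Γ_K` is `κ_U(α)`. [cite: SerreGaloisCohomology1997, I §2.4, II §1.2] -/
theorem pullback_subtype_kummerOneCocycle (α : kummerUnits K N) :
    contOneCocycles.pullback (subgroupSubtypeHom U) (Y := subgroupRep (mu K N).toTopRep U)
        (TopRep.ofHom ⟨ContinuousLinearMap.id ℤ (mu K N).toTopRep, fun _ ↦ rfl⟩) (kummerOneCocycle K N α) =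
      muSubgroupKummerCocycle K N U ⟨α, kummerUnits_le_subgroupKummerUnits K N U α.2⟩ :=
  subgroup_mu_cocycle_eq_of_muVal_eq fun _ ↦ rfl

/-- **Conjugation**, cocycle level: for `U` normal in `Γ_K` and `g ∈ Γ_K`, the conjugate cocycle
`x ↦ g·κ_U(β)(g⁻¹xg)` IS `κ_U(gβ)`. [cite: Serre1979, VII §5] [cite: SerreGaloisCohomology1997, I §2.5] -/
theorem conj_pullback_muSubgroupKummerCocycle [U.Normal] (g : absoluteGaloisGroup K)
    (β : subgroupKummerUnits K N U) :
    contOneCocycles.pullback (subgroupConj U g) (conjRepHom (mu K N).toTopRep U g)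
        (muSubgroupKummerCocycle K N U β) =
      muSubgroupKummerCocycle K N U ⟨g • (β : (AlgebraicClosure K)ˣ),
        smul_mem_subgroupKummerUnits_of_normal g β.2⟩ :=
  subgroup_mu_cocycle_eq_of_muVal_eq fun x ↦ by
    rw [conj_pullback_apply, muVal_muSubgroupKummerCocycle_apply]
    change muVal K N ((mu K N).toContRepresentation g ((muSubgroupKummerCocycle K N U β).1 (subgroupConj U g x))) = _
    rw [muVal_toContRepresentation_apply, muVal_muSubgroupKummerCocycle_apply, subgroupConj_apply_coe, smul_div',
      smul_smul, smul_smul, ← mul_assoc, ← mul_assoc, mul_inv_cancel, one_mul, mul_smul]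

/-- **Change of level**, cocycle level: for a power map `π : μ_M → μ_N`, `π(ζ) = ζ^d` in `K̄ˣ` (`M = N·d`; e.g. the
tree's `muPowMap`), `π ∘ κ_{U,M}(β) = κ_{U,N}(β^d)` — the cocycle identity behind `H¹(π) ∘ δ_M = δ_N`
(`(σβ/β)^d = σ(β^d)/β^d`). [cite: SerreGaloisCohomology1997, II §1.2] -/
theorem map_muSubgroupKummerCocycle_apply {M : ℕ} (d : ℕ) (hM : N * d = M)
    (π : MuCarrier K M →+ MuCarrier K N) (hπ : ∀ v, muVal K N (π v) = muVal K M v ^ d)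
    (β : subgroupKummerUnits K M U) (σ : U) :
    π ((muSubgroupKummerCocycle K M U β).1 σ) =
      (muSubgroupKummerCocycle K N U ⟨(β : (AlgebraicClosure K)ˣ) ^ d,
        pow_mem_subgroupKummerUnits_of_mul_eq hM β.2⟩).1 σ :=
  muVal_injective K N (by
    rw [hπ, muVal_muSubgroupKummerCocycle_apply, muVal_muSubgroupKummerCocycle_apply, div_pow, ← smul_pow'])

end Cocycle

/-! ## §3 The Kummer class `κ_U(β) ∈ H¹(U, μ_N)` and the Kummer map of the layer -/

section Class

variable (U : Subgroup (absoluteGaloisGroup K))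

/-- **The Kummer class of `β` on the subgroup `U`**: `κ_U(β) = [σ ↦ σβ/β] ∈ H¹(U, μ_N)`
(`continuousCohomology 1 (subgroupRep (mu K N).toTopRep U)`), the image of `b = β^N ∈ (K̄^U)ˣ` under the Kummer map
`Lˣ/Lˣᴺ → H¹(L, μ_N)` of the layer `L = K̄^U`, read in the subgroup model `H¹(U, ·)` of `H¹(L, ·)`.
[cite: SerreGaloisCohomology1997, II §1.2] [cite: Serre1979, X §3] -/
def muSubgroupKummerClass (β : subgroupKummerUnits K N U) :
    continuousCohomology 1 (subgroupRep (mu K N).toTopRep U) :=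
  oneCocycleClass _ (muSubgroupKummerCocycle K N U β)

/-- The Kummer class of `U` as a monoid homomorphism `β ↦ κ_U(β)` (values in `Multiplicative H¹(U, μ_N)`).
[cite: SerreGaloisCohomology1997, II §1.2] -/
def muSubgroupKummerClassHom :
    subgroupKummerUnits K N U →* Multiplicative (continuousCohomology 1 (subgroupRep (mu K N).toTopRep U)) where
  toFun β := Multiplicative.ofAdd (muSubgroupKummerClass K N U β)
  map_one' := by rw [muSubgroupKummerClass, muSubgroupKummerCocycle_one, oneCocycleClass_zero]; rfl
  map_mul' β β' := by
    rw [muSubgroupKummerClass, muSubgroupKummerCocycle_mul, oneCocycleClass_add]; rfl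

/-- Unfolding `muSubgroupKummerClassHom`. [cite: SerreGaloisCohomology1997, II §1.2] -/
theorem muSubgroupKummerClassHom_apply (β : subgroupKummerUnits K N U) :
    muSubgroupKummerClassHom K N U β = Multiplicative.ofAdd (muSubgroupKummerClass K N U β) :=
  rfl

/-- Additivity of the Kummer class in `β`. [cite: SerreGaloisCohomology1997, II §1.2] -/
theorem muSubgroupKummerClass_mul (β β' : subgroupKummerUnits K N U) :
    muSubgroupKummerClass K N U (β * β') = muSubgroupKummerClass K N U β + muSubgroupKummerClass K N U β' := by
  rw [muSubgroupKummerClass, muSubgroupKummerCocycle_mul, oneCocycleClass_add]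
  rfl

/-- The Kummer class of `1` vanishes. [cite: SerreGaloisCohomology1997, II §1.2] -/
@[simp] theorem muSubgroupKummerClass_one : muSubgroupKummerClass K N U 1 = 0 := by
  rw [muSubgroupKummerClass, muSubgroupKummerCocycle_one, oneCocycleClass_zero]

/-- The Kummer class of `β⁻¹` is `-κ_U(β)`. [cite: SerreGaloisCohomology1997, II §1.2] -/
theorem muSubgroupKummerClass_inv (β : subgroupKummerUnits K N U) :
    muSubgroupKummerClass K N U β⁻¹ = -muSubgroupKummerClass K N U β := by
  rw [eq_neg_iff_add_eq_zero, ← muSubgroupKummerClass_mul, inv_mul_cancel, muSubgroupKummerClass_one]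

variable {K N U} in
/-- The Kummer class of a `U`-fixed unit vanishes. [cite: SerreGaloisCohomology1997, II §1.2] -/
theorem muSubgroupKummerClass_eq_zero_of_forall_smul_eq (β : subgroupKummerUnits K N U)
    (hβ : ∀ σ : U, (σ : absoluteGaloisGroup K) • (β : (AlgebraicClosure K)ˣ) = β) :
    muSubgroupKummerClass K N U β = 0 := by
  rw [muSubgroupKummerClass, muSubgroupKummerCocycle_eq_zero_of_forall_smul_eq β hβ, oneCocycleClass_zero]

variable {K N U} in
/-- **The Kummer class of a root of unity vanishes**: for `β^N = 1` the cocycle `σ ↦ σβ/β` is the coboundary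
`∂β` of `β ∈ μ_N` (no hypothesis on `U`). [cite: SerreGaloisCohomology1997, II §1.2] -/
theorem muSubgroupKummerClass_eq_zero_of_pow_eq_one (β : subgroupKummerUnits K N U)
    (h : (β : (AlgebraicClosure K)ˣ) ^ N = 1) : muSubgroupKummerClass K N U β = 0 := by
  rw [muSubgroupKummerClass, oneCocycleClass_eq_zero_iff]
  refine ⟨MuCarrier.ofRootsOfUnity ⟨β, (mem_rootsOfUnity _ _).2 h⟩, fun σ ↦ muVal_injective K N ?_⟩
  rw [muVal_muSubgroupKummerCocycle_apply]
  change _ = muVal K N ((mu K N).toContRepresentation (σ : absoluteGaloisGroup K)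
    (MuCarrier.ofRootsOfUnity ⟨(β : (AlgebraicClosure K)ˣ), _⟩) - MuCarrier.ofRootsOfUnity ⟨(β : (AlgebraicClosure K)ˣ), _⟩)
  rw [muVal_sub, muVal_toContRepresentation_apply, muVal_ofRootsOfUnity]

variable {K N U} in
/-- **The Kummer class `κ_U(β)` depends on `β^N` only**: two Kummer units of `U` with the same `N`-th power differ
by a root of unity, whose class vanishes. [cite: SerreGaloisCohomology1997, II §1.2] -/
theorem muSubgroupKummerClass_eq_of_pow_eq {β β' : subgroupKummerUnits K N U}
    (h : (β : (AlgebraicClosure K)ˣ) ^ N = (β' : (AlgebraicClosure K)ˣ) ^ N) :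
    muSubgroupKummerClass K N U β = muSubgroupKummerClass K N U β' := by
  have h1 : β' = β * (β⁻¹ * β') := by rw [mul_inv_cancel_left]
  rw [h1, muSubgroupKummerClass_mul, muSubgroupKummerClass_eq_zero_of_pow_eq_one (β⁻¹ * β'), add_zero]
  rw [Subgroup.coe_mul, Subgroup.coe_inv, mul_pow, inv_pow, h, inv_mul_cancel]

/-! ### Roots and the Kummer map of the layer -/

variable [NeZero N]

/-- A chosen `N`-th root in `K̄ˣ` of a `U`-fixed unit `b` (`K̄` is algebraically closed, `N ≥ 1`), as a Kummer unit
of `U`; the class `κ_U` does not depend on the choice (`muSubgroupKummerClass_eq_of_pow_eq`).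
[cite: SerreGaloisCohomology1997, II §1.2] -/
def subgroupKummerUnitsRoot (b : (AlgebraicClosure K)ˣ) (hb : ∀ σ : U, (σ : absoluteGaloisGroup K) • b = b) :
    subgroupKummerUnits K N U :=
  have hx := Classical.choose_spec (IsAlgClosed.exists_pow_nat_eq (b : AlgebraicClosure K) (NeZero.pos N))
  have h0 : Classical.choose (IsAlgClosed.exists_pow_nat_eq (b : AlgebraicClosure K) (NeZero.pos N)) ≠ 0 := by
    intro h0
    rw [h0, zero_pow (NeZero.ne N), eq_comm] at hx
    exact b.ne_zero hx
  ⟨Units.mk0 _ h0, fun σ ↦ by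
    have hbN : Units.mk0 _ h0 ^ N = b := Units.ext (by rw [Units.val_pow_eq_pow_val, Units.val_mk0, hx])
    rw [hbN, hb σ]⟩

/-- The defining property of `subgroupKummerUnitsRoot`: `(b^{1/N})^N = b`. [cite: SerreGaloisCohomology1997, II §1.2] -/
@[simp] theorem subgroupKummerUnitsRoot_pow (b : (AlgebraicClosure K)ˣ)
    (hb : ∀ σ : U, (σ : absoluteGaloisGroup K) • b = b) :
    ((subgroupKummerUnitsRoot K N U b hb : subgroupKummerUnits K N U) : (AlgebraicClosure K)ˣ) ^ N = b :=
  Units.ext (by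
    rw [Units.val_pow_eq_pow_val]
    exact Classical.choose_spec (IsAlgClosed.exists_pow_nat_eq (b : AlgebraicClosure K) (NeZero.pos N)))

/-- **The Kummer map of the layer `L = K̄^U`**: `δ_U : (K̄ˣ)^U →* H¹(U, μ_N)`, `b ↦ κ_U(b^{1/N})` (independent of
the root), a monoid homomorphism into `Multiplicative H¹(U, μ_N)` — the connecting homomorphism of the Kummer
sequence `1 → μ_N → K̄ˣ → K̄ˣ → 1` over `L`, `Lˣ → H¹(L, μ_N)`.  For `U = Γ_K` and `b ∈ Kˣ` it is the tree's
`kummerMap K N`. [cite: SerreGaloisCohomology1997, II §1.2] [cite: Serre1979, X §3] -/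
def muSubgroupKummerMap :
    FixedPoints.subgroup U (AlgebraicClosure K)ˣ →*
      Multiplicative (continuousCohomology 1 (subgroupRep (mu K N).toTopRep U)) where
  toFun b := muSubgroupKummerClassHom K N U (subgroupKummerUnitsRoot K N U b fun σ ↦ b.2 σ)
  map_one' := by
    rw [muSubgroupKummerClassHom_apply, ← ofAdd_zero, Equiv.apply_eq_iff_eq]
    exact muSubgroupKummerClass_eq_zero_of_pow_eq_one _ (by rw [subgroupKummerUnitsRoot_pow]; rfl)
  map_mul' a b := by
    rw [← map_mul, muSubgroupKummerClassHom_apply, muSubgroupKummerClassHom_apply, Equiv.apply_eq_iff_eq]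
    refine muSubgroupKummerClass_eq_of_pow_eq ?_
    conv_rhs => rw [Subgroup.coe_mul, mul_pow, subgroupKummerUnitsRoot_pow, subgroupKummerUnitsRoot_pow]
    rw [subgroupKummerUnitsRoot_pow, Subgroup.coe_mul]

/-- `δ_U(b) = κ_U(β)` for ANY `β` with `β^N = b`. [cite: SerreGaloisCohomology1997, II §1.2] -/
theorem muSubgroupKummerMap_apply_eq (b : FixedPoints.subgroup U (AlgebraicClosure K)ˣ)
    (β : subgroupKummerUnits K N U) (hβ : (β : (AlgebraicClosure K)ˣ) ^ N = b) :
    muSubgroupKummerMap K N U b = Multiplicative.ofAdd (muSubgroupKummerClass K N U β) := by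
  change muSubgroupKummerClassHom K N U _ = _
  rw [muSubgroupKummerClassHom_apply, Equiv.apply_eq_iff_eq]
  exact muSubgroupKummerClass_eq_of_pow_eq (by rw [subgroupKummerUnitsRoot_pow, hβ])

/-- `N`-th powers of `U`-fixed units have trivial Kummer class: `((K̄ˣ)^U)^N ≤ ker δ_U`. [cite: SerreGaloisCohomology1997, II §1.2] -/
theorem muSubgroupKummerMap_pow (b : FixedPoints.subgroup U (AlgebraicClosure K)ˣ) :
    muSubgroupKummerMap K N U (b ^ N) = 1 := by
  rw [muSubgroupKummerMap_apply_eq K N U (b ^ N)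
    ⟨b, mem_subgroupKummerUnits_of_forall_smul_eq fun σ ↦ b.2 σ⟩ rfl, ← ofAdd_zero, Equiv.apply_eq_iff_eq]
  exact muSubgroupKummerClass_eq_zero_of_forall_smul_eq _ fun σ ↦ b.2 σ

end Class

/-! ## §4 Functoriality of the class: restriction, the Galois action, corestriction -/

section Functorial

variable (U : Subgroup (absoluteGaloisGroup K))

/-- **Restriction to a smaller subgroup**: `res_{U'}^{U} κ_U(β) = κ_{U'}(β)` for `U' ≤ U` (the Kummer maps of the
layers `L ⊆ L'` commute with restriction). [cite: SerreGaloisCohomology1997, I §2.4, II §1.2] -/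
theorem resLe_muSubgroupKummerClass {U' : Subgroup (absoluteGaloisGroup K)} (h : U' ≤ U)
    (β : subgroupKummerUnits K N U) :
    resLe (mu K N).toTopRep h 1 (muSubgroupKummerClass K N U β) =
      muSubgroupKummerClass K N U' ⟨β, subgroupKummerUnits_anti K N h β.2⟩ := by
  unfold muSubgroupKummerClass
  rw [resLe_oneCocycleClass, pullback_inclusion_muSubgroupKummerCocycle]

/-- **Restriction of the `Γ_K`-level Kummer class**: `res_U (kummerClassHom K N α) = κ_U(α)`.
[cite: SerreGaloisCohomology1997, I §2.4, II §1.2] -/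
theorem resSubgroup_kummerClassHom (α : kummerUnits K N) :
    resSubgroup (mu K N).toTopRep U 1 (Multiplicative.toAdd (kummerClassHom K N α)) =
      muSubgroupKummerClass K N U ⟨α, kummerUnits_le_subgroupKummerUnits K N U α.2⟩ := by
  unfold muSubgroupKummerClass
  rw [kummerClassHom_apply, toAdd_ofAdd, resSubgroup_oneCocycleClass, pullback_subtype_kummerOneCocycle]

/-- **The Galois action on layer Kummer classes**: `g · κ_U(β) = κ_U(g β)` in `H¹(U, μ_N)` for `U` normal in `Γ_K`
(`conjMap`; for `U = Gal(K̄/L)` this is the `Gal(L/K)`-equivariance of the Kummer map of `L`).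
[cite: Serre1979, VII §5] [cite: SerreGaloisCohomology1997, I §2.5] -/
theorem conjMap_muSubgroupKummerClass [U.Normal] (g : absoluteGaloisGroup K) (β : subgroupKummerUnits K N U) :
    conjMap (mu K N).toTopRep U g 1 (muSubgroupKummerClass K N U β) =
      muSubgroupKummerClass K N U ⟨g • (β : (AlgebraicClosure K)ˣ), smul_mem_subgroupKummerUnits_of_normal g β.2⟩ := by
  unfold muSubgroupKummerClass
  rw [conjMap_oneCocycleClass, conj_pullback_muSubgroupKummerCocycle]

/-! ### Corestriction: `cor_{U'/U} κ_U(β) = κ_{U'}(∏ₓ s(x)·β)` -/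

variable {U} {U' : Subgroup (absoluteGaloisGroup K)} [Fintype (U' ⧸ U.subgroupOf U')]
  {s : U' ⧸ U.subgroupOf U' → U'}

variable {K N} in
/-- `muVal` of a finite sum is the product of the `muVal`s. [folklore] -/
private theorem muVal_finset_sum {ι : Type*} (t : Finset ι) (v : ι → MuCarrier K N) :
    muVal K N (∑ i ∈ t, v i) = ∏ i ∈ t, muVal K N (v i) := by
  classical
  induction t using Finset.induction_on with
  | empty => simp
  | insert a t ha ih => rw [Finset.sum_insert ha, Finset.prod_insert ha, muVal_add, ih]

variable {K N} in
/-- **The relative transfer of a `μ_N`-valued Kummer cocycle, read in `K̄ˣ`** (the tree's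
`muVal_transferFun_of_kummer` with the ambient group `Γ_K` replaced by a subgroup `U'`): for a cocycle `f` of
`U.subgroupOf U'` with values `hβ/β`, the transfer cocycle of `U'` takes the value `gα/α` at `g`, `α = ∏ₓ s(x)·β`.
[cite: NeukirchSchmidtWingberg2008, I §5] [cite: Serre1979, X §3 b)] -/
theorem muVal_transferFun_subgroup_of_kummer (hs : ∀ x, (s x : U' ⧸ U.subgroupOf U') = x)
    (f : contOneCocycles (subgroupRep (subgroupRep (mu K N).toTopRep U') (U.subgroupOf U')))
    (β : (AlgebraicClosure K)ˣ)
    (hf : ∀ h : U.subgroupOf U', muVal K N (f.1 h) = ((h : U') : absoluteGaloisGroup K) • β / β) (g : U') :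
    muVal K N (transferFun (subgroupRep (mu K N).toTopRep U') (U.subgroupOf U') hs f g) =
      (g : absoluteGaloisGroup K) • (∏ x : U' ⧸ U.subgroupOf U', ((s x : U') : absoluteGaloisGroup K) • β) /
        ∏ x : U' ⧸ U.subgroupOf U', ((s x : U') : absoluteGaloisGroup K) • β := by
  rw [transferFun_apply, muVal_finset_sum]
  have key : ∀ x : U' ⧸ U.subgroupOf U',
      muVal K N ((subgroupRep (mu K N).toTopRep U').ρ (s (g • x)) (f.1 (schreierElt (U.subgroupOf U') hs g x))) =
        (g : absoluteGaloisGroup K) • (((s x : U') : absoluteGaloisGroup K) • β) /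
          (((s (g • x) : U') : absoluteGaloisGroup K) • β) := by
    intro x
    change muVal K N ((mu K N).toContRepresentation ((s (g • x) : U') : absoluteGaloisGroup K)
      (f.1 (schreierElt (U.subgroupOf U') hs g x))) = _
    have hx : (((schreierElt (U.subgroupOf U') hs g x : U.subgroupOf U') : U') : absoluteGaloisGroup K) =
        ((s (g • x) : U') : absoluteGaloisGroup K)⁻¹ * (g : absoluteGaloisGroup K) *
          ((s x : U') : absoluteGaloisGroup K) := by
      rw [schreierElt_coe, Subgroup.coe_mul, Subgroup.coe_mul, Subgroup.coe_inv]
    rw [muVal_toContRepresentation_apply, hf, hx, smul_div', ← mul_smul, ← mul_smul, mul_assoc,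
      mul_inv_cancel_left]
  rw [Finset.prod_congr rfl fun x _ ↦ key x, Finset.prod_div_distrib, Finset.smul_prod']
  congr 1
  exact Equiv.prod_comp (MulAction.toPerm g) (fun y ↦ ((s y : U') : absoluteGaloisGroup K) • β)

/-- ★ **`cor_{U'/U} κ_U(β) = κ_{U'}(∏ₓ s(x)·β)`**: the relative corestriction (`coresLe`, `U ≤ U'`, `U` open of
finite index in `U'`) of the Kummer class of `β` on `U` is the Kummer class on `U'` of the norm element
`α = ∏_{x ∈ U'/U} s(x)·β`, for ANY section `s` of `U' → U'/U` (`α^N = ∏ₓ s(x)·β^N` is the norm of `b = β^N` from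
`K̄^U` to `K̄^{U'}`: «`Cor_{L'/L} ∘ δ_{L'} = δ_L ∘ N_{L'/L}`»).
[cite: NeukirchSchmidtWingberg2008, I §5 (1.5.x), (cor in degree 0 is the norm)] [cite: Serre1979, X §3 b)] -/
theorem coresLe_muSubgroupKummerClass (h : U ≤ U') (hU : IsOpen (U : Set (absoluteGaloisGroup K)))
    (hs : ∀ x, (s x : U' ⧸ U.subgroupOf U') = x) (β : subgroupKummerUnits K N U) :
    coresLe (mu K N).toTopRep h hU (muSubgroupKummerClass K N U β) =
      muSubgroupKummerClass K N U'
        ⟨∏ x : U' ⧸ U.subgroupOf U', ((s x : U') : absoluteGaloisGroup K) • (β : (AlgebraicClosure K)ˣ),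
          prod_smul_mem_subgroupKummerUnits hs β.2⟩ := by
  unfold muSubgroupKummerClass
  rw [coresLe_oneCocycleClass _ h hU hs]
  refine congrArg _ (subgroup_mu_cocycle_eq_of_muVal_eq fun g ↦ ?_)
  rw [transferCocycle_apply, muVal_muSubgroupKummerCocycle_apply]
  exact muVal_transferFun_subgroup_of_kummer hs _ (β : (AlgebraicClosure K)ˣ) (fun _ ↦ rfl) g

/-- **`cor_{U'/U} κ_U(β) = κ_{U'}(α)` for any `α` with `α^N = ∏ₓ s(x)·β^N`** (root-free form of ★: the corestricted
class is the Kummer class of ANY `N`-th root of the norm of `b = β^N`).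
[cite: NeukirchSchmidtWingberg2008, I §5] [cite: Serre1979, X §3 b)] -/
theorem coresLe_muSubgroupKummerClass_eq_of_pow_eq (h : U ≤ U') (hU : IsOpen (U : Set (absoluteGaloisGroup K)))
    (hs : ∀ x, (s x : U' ⧸ U.subgroupOf U') = x) (β : subgroupKummerUnits K N U)
    (α : subgroupKummerUnits K N U')
    (hα : (α : (AlgebraicClosure K)ˣ) ^ N =
      ∏ x : U' ⧸ U.subgroupOf U', ((s x : U') : absoluteGaloisGroup K) • (β : (AlgebraicClosure K)ˣ) ^ N) :
    coresLe (mu K N).toTopRep h hU (muSubgroupKummerClass K N U β) = muSubgroupKummerClass K N U' α := by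
  rw [coresLe_muSubgroupKummerClass K N h hU hs β]
  exact muSubgroupKummerClass_eq_of_pow_eq (by rw [hα]; exact prod_smul_pow_eq _)

end Functorial

/-! ## §5 Kummer cocycles of `𝔓`-units vanish on inertia (`𝔓 ∌ N`; any field `K`, `ℤ̄_K = absIntegers (𝓞 K) K`) -/

section Inertia

open scoped NumberField

variable {K N} {U : Subgroup (absoluteGaloisGroup K)}

/-- ★ **The Kummer cocycle of a `𝔓`-unit vanishes on inertia at `𝔓 ∌ N`.**  Let `𝔓` be a prime of `ℤ̄_K =
absIntegers (𝓞 K) K` with `N ∉ 𝔓`, `β` a Kummer unit of `U` which is an algebraic integer outside `𝔓`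
(`β = α ∈ ℤ̄_K`, `α ∉ 𝔓`).  Then `κ_U(β)(σ) = 0` for every `σ ∈ U` in the inertia group `I_𝔓`: `σ` fixes `β^N`,
hence fixes the `N`-th root `β` of the `𝔓`-unit `β^N` (`smul_eq_self_of_mem_inertia_of_pow_eq`) — the layer
`K̄^U(β)/K̄^U` is unramified at `𝔓`. [cite: Lang1983, Ch. 6 Prop. 1.3] [cite: SerreGaloisCohomology1997, II §1.2] -/
theorem muSubgroupKummerCocycle_apply_eq_zero_of_mem_inertia (β : subgroupKummerUnits K N U)
    {𝔓 : Ideal (absIntegers (𝓞 K) K)} [𝔓.IsPrime] (hN𝔓 : ((N : ℕ) : absIntegers (𝓞 K) K) ∉ 𝔓)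
    {α : absIntegers (𝓞 K) K} (hαβ : (α : AlgebraicClosure K) = ((β : (AlgebraicClosure K)ˣ) : AlgebraicClosure K))
    (hα𝔓 : α ∉ 𝔓) (σ : U) (hσ : (σ : absoluteGaloisGroup K) ∈ 𝔓.inertia (absoluteGaloisGroup K)) :
    (muSubgroupKummerCocycle K N U β).1 σ = 0 := by
  apply muVal_injective K N
  rw [muVal_muSubgroupKummerCocycle_apply, muVal_zero, div_eq_one]
  have hαN𝔓 : α ^ N ∉ 𝔓 := fun h ↦ hα𝔓 (‹𝔓.IsPrime›.mem_of_pow_mem N h)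
  have hσa : (σ : absoluteGaloisGroup K) • α ^ N = α ^ N := by
    apply Subtype.ext
    have h := congrArg (fun u : (AlgebraicClosure K)ˣ ↦ (u : AlgebraicClosure K)) (β.2 σ)
    simp only [Units.coe_smul, Units.val_pow_eq_pow_val] at h
    rw [integralClosure.coe_smul, SubmonoidClass.coe_pow, hαβ]
    exact h
  have h := smul_eq_self_of_mem_inertia_of_pow_eq 𝔓 hN𝔓 hαN𝔓 rfl hσ hσa
  have h' := congrArg (fun x : absIntegers (𝓞 K) K ↦ (x : AlgebraicClosure K)) h
  simp only [integralClosure.coe_smul, hαβ] at h'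
  exact Units.ext (by rw [Units.coe_smul]; exact h')

/-- **`res_{U ⊓ I_𝔓} κ_U(β) = 0` for a `𝔓`-unit `β`, `𝔓 ∌ N`** — the class-level form of ★: the Kummer class of an
`N`-th root of a `𝔓`-unit of the layer is unramified at `𝔓` (the condition defining `H¹(O_L[1/N], μ_N) ⊆ H¹(L, μ_N)`
in the currency of `Kato2004.CM.integralH1K`). [cite: Lang1983, Ch. 6 Prop. 1.3] [cite: SerreGaloisCohomology1997, II §1.2] -/
theorem resLe_inf_inertia_muSubgroupKummerClass (β : subgroupKummerUnits K N U)
    {𝔓 : Ideal (absIntegers (𝓞 K) K)} [𝔓.IsPrime] (hN𝔓 : ((N : ℕ) : absIntegers (𝓞 K) K) ∉ 𝔓)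
    {α : absIntegers (𝓞 K) K} (hαβ : (α : AlgebraicClosure K) = ((β : (AlgebraicClosure K)ˣ) : AlgebraicClosure K))
    (hα𝔓 : α ∉ 𝔓) :
    resLe (mu K N).toTopRep (inf_le_left : U ⊓ 𝔓.inertia (absoluteGaloisGroup K) ≤ U) 1
        (muSubgroupKummerClass K N U β) = 0 := by
  rw [resLe_muSubgroupKummerClass]
  refine muSubgroupKummerClass_eq_zero_of_forall_smul_eq _ fun σ ↦ ?_
  have h := muSubgroupKummerCocycle_apply_eq_zero_of_mem_inertia
    (⟨β, subgroupKummerUnits_anti K N inf_le_left β.2⟩ : subgroupKummerUnits K N (U ⊓ 𝔓.inertia _))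
    hN𝔓 hαβ hα𝔓 σ (Subgroup.mem_inf.mp σ.2).2
  have h' := congrArg (muVal K N) h
  rw [muVal_muSubgroupKummerCocycle_apply, muVal_zero, div_eq_one] at h'
  exact h'

end Inertia

end Literature.NumberTheory.GaloisRepresentations

end
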